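import Mathlib

/-!
# Beta / MultiscalePartitionNormalize — NODE (w4-a) OF THE O.2 SKELETON §8.9: A PARTITION OF UNITY `Σ_z h_z² = 1` BY NORMALISATION, WITH
# SITEWISE (SCALE-ADAPTED) GRADIENT BOUNDS (MODEL; generic finite bookkeeping, the SHAPE of [B5] (1.118) ∕ [B6] (2.36))

Given nonnegative bumps `h̃_z` (`z` in a finite index type) on any carrier `X` with `Σ_z h̃_z(x)² ≥ m₀ > 0` everywhere, the normalised family
`h_z := h̃_z / √(Σ_w h̃_w²)` is a partition of unity `Σ_z h_z(x)² = 1` with `0 ≤ h_z ≤ 1`, the same supports, and TWO-POINT increments controlled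
SITEWISE: if `|h̃_z(x) − h̃_z(y)| ≤ g_z` and at most `k` indices are active at `x` or `y`, each with increment `≤ ḡ`, then
**`|h_z(x) − h_z(y)| ≤ (g_z + √k·ḡ)/√m₀`**.  With scale-adapted bumps (`g_z = C_h/(M·S_{l(z)})` across a bond, active indices of comparable
levels) this is the level-free gradient bound `|∂h_z| ≲ 1/(M·S_l)` that node (w4-b)'s remainder estimate consumes — no geometry is fixed here
(unit `b2b-balaban-beta-d4-p2`, GEN 8, MODEL crew; O.2 skeleton v1.4.0 §8.9 DESIGN, sub-node (w4-a); the EXISTENCE of adapted bumps on a concrete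
graded cell family is (w4-a′), separate).

HONEST FRAMING: discharging `BetaPertH` makes Bałaban's UV stability UNCONDITIONAL — NOT the continuum limit, NOT the Clay problem.
HONEST DEPENDENCY (verbatim): «continuum YM on T⁴ ⇐ BetaPertH ∧ nine spine estimates (0/9 proved); BetaPertH ⇐ (D1) ∧ (D4) ∧ CAP+tail;
G-an2-4 gates asym, D1 and NE2/3/4.»  THIS MODULE DISCHARGES NOTHING of `BetaPertH`, asserts NOTHING printed and cites nothing as a fact
(ABSOLUTE RULE): [folklore] real analysis on a finite index set (Cauchy–Schwarz, the reverse triangle inequality for `√(Σ a²)`); bumps,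
floor `m₀`, increments are DATA.  LOCI (shape only): [B5] = `Balaban1984PropagatorsI` (1.118) p. 37 (the smooth partition `Σ_□ h_□² = 1`);
[B6] = `Balaban1984PropagatorsII` (2.36) p. 229 («We construct also the corresponding family of functions h_□ … and rescale them to proper
scales»).  No class change on row D4 (critical-path width 0; D4 DISCHARGE NO DATE); NOT BetaPertH, NOT continuum, NOT Clay, NOT summit progress.
-/

namespace Summit.QuantumFields.BalabanUV.Beta.MultiscalePartitionNormalize

open Finset

noncomputable section

variable {X Z : Type} [Fintype Z]

/-! ## §1 The square sum and the normalised family -/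

/-- The pointwise square sum `Σ_z h̃_z(x)²`. [folklore] -/
def sqSum (ht : Z → X → ℝ) (x : X) : ℝ := ∑ z, ht z x ^ 2

/-- [folklore] -/
theorem sqSum_nonneg (ht : Z → X → ℝ) (x : X) : 0 ≤ sqSum ht x := sum_nonneg fun _ _ => sq_nonneg _

/-- One bump is dominated by the square sum: `h̃_z(x)² ≤ Σ_w h̃_w(x)²`. [folklore] -/
theorem sq_le_sqSum (ht : Z → X → ℝ) (z : Z) (x : X) : ht z x ^ 2 ≤ sqSum ht x :=
  Finset.single_le_sum (f := fun w => ht w x ^ 2) (fun _ _ => sq_nonneg _) (mem_univ z)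

/-- **The normalised family** `h_z := h̃_z / √(Σ_w h̃_w²)` ([B5] (1.118) SHAPE). [cite: Balaban1984PropagatorsI, (1.118) p.37] -/
def puNorm (ht : Z → X → ℝ) (z : Z) (x : X) : ℝ := ht z x / Real.sqrt (sqSum ht x)

/-- **Partition of unity**: where the square sum is positive, `Σ_z h_z(x)² = 1`. [cite: Balaban1984PropagatorsI, (1.118) p.37] -/
theorem sum_sq_puNorm {ht : Z → X → ℝ} {x : X} (hpos : 0 < sqSum ht x) : ∑ z, puNorm ht z x ^ 2 = 1 := by
  unfold puNorm
  have hs : Real.sqrt (sqSum ht x) ^ 2 = sqSum ht x := Real.sq_sqrt hpos.le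
  have hs0 : Real.sqrt (sqSum ht x) ≠ 0 := (Real.sqrt_pos.mpr hpos).ne'
  calc ∑ z, (ht z x / Real.sqrt (sqSum ht x)) ^ 2 = (∑ z, ht z x ^ 2) / Real.sqrt (sqSum ht x) ^ 2 := by
        rw [Finset.sum_div]
        exact Finset.sum_congr rfl fun z _ => by rw [div_pow]
    _ = 1 := by rw [hs]; exact div_self hpos.ne'

/-- Nonnegative bumps give nonnegative normalised bumps. [folklore] -/
theorem puNorm_nonneg {ht : Z → X → ℝ} (h0 : ∀ z x, 0 ≤ ht z x) (z : Z) (x : X) : 0 ≤ puNorm ht z x :=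
  div_nonneg (h0 z x) (Real.sqrt_nonneg _)

/-- Normalised bumps are `≤ 1` in absolute value. [folklore] -/
theorem abs_puNorm_le_one (ht : Z → X → ℝ) (z : Z) (x : X) : |puNorm ht z x| ≤ 1 := by
  unfold puNorm
  by_cases h0 : sqSum ht x = 0
  · have : ht z x = 0 := by
      have := sq_le_sqSum ht z x
      rw [h0] at this
      exact pow_eq_zero_iff (n := 2) (by norm_num) |>.mp (le_antisymm this (sq_nonneg _))
    simp [this]
  · have hpos : 0 < sqSum ht x := lt_of_le_of_ne (sqSum_nonneg ht x) (Ne.symm h0)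
    rw [abs_div, abs_of_pos (Real.sqrt_pos.mpr hpos), div_le_one (Real.sqrt_pos.mpr hpos), ← Real.sqrt_sq_eq_abs]
    exact Real.sqrt_le_sqrt (sq_le_sqSum ht z x)

/-- Supports are preserved: `h̃_z(x) = 0 ⟹ h_z(x) = 0`. [folklore] -/
theorem puNorm_eq_zero {ht : Z → X → ℝ} {z : Z} {x : X} (h : ht z x = 0) : puNorm ht z x = 0 := by
  rw [puNorm, h, zero_div]

/-! ## §2 The reverse triangle inequality for the square-sum norm -/

/-- Cauchy–Schwarz: `Σ a_z b_z ≤ √(Σ a²)·√(Σ b²)`. [folklore] -/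
theorem sum_mul_le_sqrt_mul_sqrt (a b : Z → ℝ) :
    ∑ z, a z * b z ≤ Real.sqrt (∑ z, a z ^ 2) * Real.sqrt (∑ z, b z ^ 2) := by
  have hcs := Finset.sum_mul_sq_le_sq_mul_sq (s := univ) a b
  have h0 : 0 ≤ Real.sqrt (∑ z, a z ^ 2) * Real.sqrt (∑ z, b z ^ 2) := mul_nonneg (Real.sqrt_nonneg _) (Real.sqrt_nonneg _)
  have hsq : (Real.sqrt (∑ z, a z ^ 2) * Real.sqrt (∑ z, b z ^ 2)) ^ 2 = (∑ z, a z ^ 2) * (∑ z, b z ^ 2) := by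
    rw [mul_pow, Real.sq_sqrt (sum_nonneg fun _ _ => sq_nonneg _), Real.sq_sqrt (sum_nonneg fun _ _ => sq_nonneg _)]
  exact (abs_le_of_sq_le_sq' (by rw [hsq]; exact hcs) h0).2

/-- **Reverse triangle inequality**: `|√(Σ a²) − √(Σ b²)| ≤ √(Σ (a − b)²)`. [folklore] -/
theorem abs_sqrt_sub_sqrt_le (a b : Z → ℝ) :
    |Real.sqrt (∑ z, a z ^ 2) - Real.sqrt (∑ z, b z ^ 2)| ≤ Real.sqrt (∑ z, (a z - b z) ^ 2) := by
  set A := ∑ z, a z ^ 2 with hA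
  set B := ∑ z, b z ^ 2 with hB
  set C := ∑ z, (a z - b z) ^ 2 with hC
  have hA0 : 0 ≤ A := sum_nonneg fun _ _ => sq_nonneg _
  have hB0 : 0 ≤ B := sum_nonneg fun _ _ => sq_nonneg _
  have hC0 : 0 ≤ C := sum_nonneg fun _ _ => sq_nonneg _
  have hCexp : C = A + B - 2 * ∑ z, a z * b z := by
    rw [hC, hA, hB, Finset.mul_sum, ← Finset.sum_add_distrib, ← Finset.sum_sub_distrib]
    exact Finset.sum_congr rfl fun z _ => by ring
  have hcs := sum_mul_le_sqrt_mul_sqrt a b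
  -- (√A − √B)² ≤ C
  have hkey : (Real.sqrt A - Real.sqrt B) ^ 2 ≤ C := by
    have e : (Real.sqrt A - Real.sqrt B) ^ 2 = A + B - 2 * (Real.sqrt A * Real.sqrt B) := by
      rw [sub_sq, Real.sq_sqrt hA0, Real.sq_sqrt hB0]; ring
    rw [e, hCexp]
    linarith
  calc |Real.sqrt A - Real.sqrt B| = Real.sqrt ((Real.sqrt A - Real.sqrt B) ^ 2) := (Real.sqrt_sq_eq_abs _).symm
    _ ≤ Real.sqrt C := Real.sqrt_le_sqrt hkey

/-- Increments vanish off the active set and are bounded by `ḡ` on it: `Σ_z (a_z − b_z)² ≤ k·ḡ²` when at most `k` indices have `a_z ≠ 0 ∨ b_z ≠ 0`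
and `|a_z − b_z| ≤ ḡ` for those. [folklore] -/
theorem sum_sq_sub_le [DecidableEq Z] (a b : Z → ℝ) {k : ℕ} (hk : (univ.filter fun z => a z ≠ 0 ∨ b z ≠ 0).card ≤ k) {gbar : ℝ}
    (hg : ∀ z, a z ≠ 0 ∨ b z ≠ 0 → |a z - b z| ≤ gbar) : ∑ z, (a z - b z) ^ 2 ≤ k * gbar ^ 2 := by
  classical
  have hsplit : ∑ z, (a z - b z) ^ 2 = ∑ z ∈ univ.filter (fun z => a z ≠ 0 ∨ b z ≠ 0), (a z - b z) ^ 2 := by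
    symm
    refine Finset.sum_subset (Finset.filter_subset _ _) fun z _ hz => ?_
    rw [mem_filter, not_and] at hz
    have h := hz (mem_univ z)
    push Not at h
    rw [h.1, h.2, sub_zero, zero_pow two_ne_zero]
  rw [hsplit]
  have hgbar : ∀ z ∈ univ.filter (fun z => a z ≠ 0 ∨ b z ≠ 0), (a z - b z) ^ 2 ≤ gbar ^ 2 := by
    intro z hz
    have h := hg z (mem_filter.mp hz).2
    rw [← sq_abs]
    exact pow_le_pow_left₀ (abs_nonneg _) h 2
  calc ∑ z ∈ univ.filter (fun z => a z ≠ 0 ∨ b z ≠ 0), (a z - b z) ^ 2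
      ≤ ∑ z ∈ univ.filter (fun z => a z ≠ 0 ∨ b z ≠ 0), gbar ^ 2 := Finset.sum_le_sum hgbar
    _ = ((univ.filter fun z => a z ≠ 0 ∨ b z ≠ 0).card : ℝ) * gbar ^ 2 := by rw [Finset.sum_const, nsmul_eq_mul]
    _ ≤ k * gbar ^ 2 := mul_le_mul_of_nonneg_right (by exact_mod_cast hk) (sq_nonneg _)

/-! ## §3 The sitewise increment bound of the normalised family -/

/-- **SITEWISE INCREMENT BOUND OF THE NORMALISED PARTITION (MODEL; node (w4-a)).**  Bumps `h̃` (any sign), a floor `0 < m₀ ≤ Σ_w h̃_w²` at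
`x` and at `y`, an increment `|h̃_z(x) − h̃_z(y)| ≤ g_z` for the index at hand, at most `k` indices active at `x` or `y` with increments `≤ ḡ`
there: **`|h_z(x) − h_z(y)| ≤ (g_z + √k·ḡ)/√m₀`** — a bound by the LOCAL data at `x, y` only (for scale-adapted bumps across a bond of a
level-`l` region: `g ≍ 1/(M·S_l)`, `k ≤ 2ν`, hence `|∂h_z| ≲ (1 + √(2ν))/(√m₀·M·S_l)`, level-free).
[cite: Balaban1984PropagatorsI, (1.118) p.37; Balaban1984PropagatorsII, (2.36) p.229] -/
theorem abs_puNorm_sub_le [DecidableEq Z] {ht : Z → X → ℝ} {m₀ : ℝ} (hm₀ : 0 < m₀) {x y : X}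
    (hx : m₀ ≤ sqSum ht x) (hy : m₀ ≤ sqSum ht y) (z : Z) {g gbar : ℝ} (hgz : |ht z x - ht z y| ≤ g)
    {k : ℕ} (hk : (univ.filter fun w => ht w x ≠ 0 ∨ ht w y ≠ 0).card ≤ k)
    (hg : ∀ w, ht w x ≠ 0 ∨ ht w y ≠ 0 → |ht w x - ht w y| ≤ gbar) :
    |puNorm ht z x - puNorm ht z y| ≤ (g + Real.sqrt k * gbar) / Real.sqrt m₀ := by
  set Nx := Real.sqrt (sqSum ht x) with hNx
  set Ny := Real.sqrt (sqSum ht y) with hNy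
  have hsm : 0 < Real.sqrt m₀ := Real.sqrt_pos.mpr hm₀
  have hNx_ge : Real.sqrt m₀ ≤ Nx := Real.sqrt_le_sqrt hx
  have hNy_ge : Real.sqrt m₀ ≤ Ny := Real.sqrt_le_sqrt hy
  have hNx0 : 0 < Nx := lt_of_lt_of_le hsm hNx_ge
  have hNy0 : 0 < Ny := lt_of_lt_of_le hsm hNy_ge
  have hgbar0 : 0 ≤ gbar := by
    by_cases hact : ∃ w, ht w x ≠ 0 ∨ ht w y ≠ 0
    · obtain ⟨w, hw⟩ := hact
      exact (abs_nonneg _).trans (hg w hw)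
    · -- nothing active: then ht z x = ht z y = 0 and the claim is trivial after all; but we only need 0 ≤ gbar when used with √k;
      -- in this branch √k·gbar may be negative only if k > 0; handle by showing the square sum vanishes, contradicting the floor
      push Not at hact
      exfalso
      have : sqSum ht x = 0 := Finset.sum_eq_zero fun w _ => by rw [(hact w).1]; ring
      linarith
  -- decomposition h_z(x) − h_z(y) = (h̃x − h̃y)/Nx + h̃y·(1/Nx − 1/Ny)
  have hdec : puNorm ht z x - puNorm ht z y = (ht z x - ht z y) / Nx + ht z y / Ny * ((Ny - Nx) / Nx) := by
    rw [puNorm, puNorm, ← hNx, ← hNy]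
    field_simp
    ring
  -- first term
  have h1 : |(ht z x - ht z y) / Nx| ≤ g / Real.sqrt m₀ := by
    rw [abs_div, abs_of_pos hNx0]
    exact div_le_div₀ ((abs_nonneg _).trans hgz) hgz hsm hNx_ge
  -- second term: h̃y/Ny ≤ 1 and |Ny − Nx| ≤ √k·ḡ
  have hratio : |ht z y / Ny| ≤ 1 := by
    have := abs_puNorm_le_one ht z y
    rwa [puNorm, ← hNy] at this
  have hNN : |Ny - Nx| ≤ Real.sqrt k * gbar := by
    rw [abs_sub_comm, hNx, hNy, sqSum, sqSum]
    refine (abs_sqrt_sub_sqrt_le (fun w => ht w x) (fun w => ht w y)).trans ?_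
    have hs := sum_sq_sub_le (fun w => ht w x) (fun w => ht w y) hk hg
    calc Real.sqrt (∑ w, (ht w x - ht w y) ^ 2) ≤ Real.sqrt (k * gbar ^ 2) := Real.sqrt_le_sqrt hs
      _ = Real.sqrt k * gbar := by rw [Real.sqrt_mul (Nat.cast_nonneg _), Real.sqrt_sq hgbar0]
  have h2 : |ht z y / Ny * ((Ny - Nx) / Nx)| ≤ Real.sqrt k * gbar / Real.sqrt m₀ := by
    rw [abs_mul, abs_div (Ny - Nx) Nx, abs_of_pos hNx0]
    calc |ht z y / Ny| * (|Ny - Nx| / Nx) ≤ 1 * (Real.sqrt k * gbar / Real.sqrt m₀) := by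
          refine mul_le_mul hratio (div_le_div₀ (mul_nonneg (Real.sqrt_nonneg _) hgbar0) hNN hsm hNx_ge) ?_ zero_le_one
          exact div_nonneg (abs_nonneg _) hNx0.le
      _ = Real.sqrt k * gbar / Real.sqrt m₀ := one_mul _
  rw [hdec]
  calc |(ht z x - ht z y) / Nx + ht z y / Ny * ((Ny - Nx) / Nx)|
      ≤ |(ht z x - ht z y) / Nx| + |ht z y / Ny * ((Ny - Nx) / Nx)| := abs_add_le _ _
    _ ≤ g / Real.sqrt m₀ + Real.sqrt k * gbar / Real.sqrt m₀ := add_le_add h1 h2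
    _ = (g + Real.sqrt k * gbar) / Real.sqrt m₀ := by rw [add_div]

end

end Summit.QuantumFields.BalabanUV.Beta.MultiscalePartitionNormalize
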